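import Mathlib
import Summits.ABC.ABC.Statement
import Summits.ABC.ABC.Theorems.SoloInformedBakerXi

/-!
# Baker's change (i) alone reaches subexponential abc
(solo-ABC-informed, session 12)

Baker describes the passage from the classical theory of logarithmic forms to a result "of the
strength of the abc-conjecture" as two changes to the Baker–Wüstholz inequality
`log |Λ| > −C(n,d) h′(α₁)⋯h′(αₙ) h′(L)`: **(i)** replace the archimedean `|Λ|` by the all-places
quantity `Ξ = min(1,|Λ|) ∏ₚ min(1, p|Λ|ₚ)`, and **(ii)** replace the *product* of the heights
`h′(α₁)⋯h′(αₙ)` by their *sum* [cite: Baker2004, §2 (p. 256)]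
[cite: BakerWustholz2007, §3.7 (p. 68)].  `SoloInformedBakerXi.lean` shows that (i) + (ii) with the
factor `h′(L) = log u` dropped is *equivalent* to `abc`, and `SoloInformedQuasiPolyABC.lean` that
(i) + (ii) with `log u` kept (Baker's "slightly weaker form") gives quasi-polynomial abc.

This file types **change (i) alone** for the linear form `Λ = log(c/a)` of an abc triple — the
product of the heights `∏_{p ∣ ca} log p` kept, a Matveev-type constant `c₀^{ω(ca)}` kept, `log u`
kept (`u ≥` the exponents in `ca`, floored at `3`):

  `log Ξ ≥ −K · c₀^{ω(ca)} · (∏_{p ∣ ca} log p) · log max(u,3)`,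

and proves that it already yields **subexponential abc** `∀ ε > 0 ∃ K', log c ≤ K' rad(abc)^ε`
(`soloInformed_subexpABC_of_productXi`) — the same rung as the one-place products-of-heights door
`H(σ)` of `SoloInformedDoorB.lean`.  The one arithmetic input is
`soloInformed_prod_mul_log_le_radical_rpow`: `∏_{p ∣ n} (c₀ log p) ≤ C_δ rad(n)^δ` for every
`δ > 0` (split the primes of `n` at the point beyond which `c₀ log p ≤ p^δ`).  So, on the seat's
ladder `abc ⟹ W ⟹ W_q ⟹ W⁻`: (i) alone ⟹ `W⁻`; (i)+(ii) ⟹ `W_q`; (i)+(ii)+(no `log u`) ⟺ `abc`.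
No claim is made about any of these estimates themselves.
-/
noncomputable section

open Real UniqueFactorizationMonoid
open Literature.NumberTheory.DiophantineGeometry
open scoped ArithmeticFunction.omega Nat

namespace Summit.ABC.ABC.Theorems

variable {a b c : ℕ}

/-- Baker's `Ξ` for the linear form `log(c/a)` of the triple `a + b = c`, written out as in
`SoloInformedBakerXi.lean` (no constant is introduced). [cite: Baker2004, §2 (p. 256)] -/
local notation "ΞB(" a ", " b ", " c ")" =>
  (min 1 (Real.log ((c : ℝ) / (a : ℝ))) *
    ∏ p ∈ Nat.primeFactors b, min 1 ((p : ℝ) / (p : ℝ) ^ Nat.factorization b p))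

/-- **Products of `log p` over the primes of `n` are `O_δ(rad(n)^δ)`**: for `c₀ ≥ 0` and `δ > 0`
there is `C ≥ 1` with `∏_{p ∣ n} (c₀ log p) ≤ C · rad(n)^δ` for all `n` — split the primes of `n`
at a threshold `B` beyond which `c₀ log p ≤ p^δ`; below `B` there are at most `⌈B⌉` primes, each
contributing at most `max(1, c₀ log ⌈B⌉)`. [folklore] -/
theorem soloInformed_prod_mul_log_le_radical_rpow {c₀ δ : ℝ} (hc₀ : 0 ≤ c₀) (hδ : 0 < δ) :
    ∃ C : ℝ, 1 ≤ C ∧ ∀ n : ℕ,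
      ∏ p ∈ n.primeFactors, c₀ * Real.log (p : ℝ) ≤ C * ((radical n : ℕ) : ℝ) ^ δ := by
  have hlo := (isLittleO_log_rpow_atTop hδ).bound
    (show (0 : ℝ) < 1 / (c₀ + 1) by positivity)
  obtain ⟨B, hB⟩ := Filter.eventually_atTop.mp hlo
  set M : ℝ := max 1 (c₀ * Real.log (⌈B⌉₊ : ℝ)) with hM_def
  have hM1 : 1 ≤ M := le_max_left _ _
  refine ⟨M ^ ⌈B⌉₊, one_le_pow₀ hM1, fun n => ?_⟩
  set S := n.primeFactors with hS_def
  have hf0 : ∀ p ∈ S, 0 ≤ c₀ * Real.log (p : ℝ) := fun p hp =>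
    mul_nonneg hc₀ (Real.log_nonneg
      (by exact_mod_cast (Nat.prime_of_mem_primeFactors hp).one_lt.le))
  rw [← Finset.prod_filter_mul_prod_filter_not S (fun p : ℕ => (p : ℝ) < B)]
  -- primes below the threshold: at most `⌈B⌉` of them, each factor at most `M`
  have h1 : ∏ p ∈ S.filter (fun p : ℕ => (p : ℝ) < B), c₀ * Real.log (p : ℝ) ≤ M ^ ⌈B⌉₊ := by
    calc ∏ p ∈ S.filter (fun p : ℕ => (p : ℝ) < B), c₀ * Real.log (p : ℝ)
        ≤ ∏ p ∈ S.filter (fun p : ℕ => (p : ℝ) < B), M := by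
          apply Finset.prod_le_prod
          · intro p hp; exact hf0 p (Finset.mem_of_mem_filter p hp)
          · intro p hp
            rw [Finset.mem_filter] at hp
            have hp1 : (1 : ℝ) ≤ p := by
              exact_mod_cast (Nat.prime_of_mem_primeFactors hp.1).one_lt.le
            have hpB : (p : ℝ) ≤ (⌈B⌉₊ : ℝ) := hp.2.le.trans (Nat.le_ceil B)
            calc c₀ * Real.log p ≤ c₀ * Real.log (⌈B⌉₊ : ℝ) :=
                  mul_le_mul_of_nonneg_left (Real.log_le_log (by linarith) hpB) hc₀
              _ ≤ M := le_max_right _ _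
      _ = M ^ (S.filter (fun p : ℕ => (p : ℝ) < B)).card := Finset.prod_const M
      _ ≤ M ^ ⌈B⌉₊ := by
          apply pow_le_pow_right₀ hM1
          calc (S.filter (fun p : ℕ => (p : ℝ) < B)).card ≤ (Finset.range ⌈B⌉₊).card := by
                apply Finset.card_le_card
                intro p hp
                rw [Finset.mem_filter] at hp
                exact Finset.mem_range.mpr (Nat.lt_ceil.mpr hp.2)
            _ = ⌈B⌉₊ := Finset.card_range _
  -- primes above the threshold: `c₀ log p ≤ p^δ`, and `∏ p^δ ≤ rad(n)^δ`
  have h2 : ∏ p ∈ S.filter (fun p : ℕ => ¬ (p : ℝ) < B), c₀ * Real.log (p : ℝ) ≤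
      ((radical n : ℕ) : ℝ) ^ δ := by
    set S₂ := S.filter (fun p : ℕ => ¬ (p : ℝ) < B) with hS₂
    have hsub : (∏ p ∈ S₂, p : ℕ) ≤ radical n := by
      rw [Nat.radical_eq_prod_primeFactors]
      exact Finset.prod_le_prod_of_subset_of_one_le' (Finset.filter_subset _ _)
        (fun p hp _ => (Nat.prime_of_mem_primeFactors hp).one_lt.le)
    have hsubR : (∏ p ∈ S₂, (p : ℝ)) ≤ ((radical n : ℕ) : ℝ) := by
      rw [← Nat.cast_prod]; exact_mod_cast hsub
    calc ∏ p ∈ S₂, c₀ * Real.log (p : ℝ) ≤ ∏ p ∈ S₂, (p : ℝ) ^ δ := by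
          apply Finset.prod_le_prod
          · intro p hp; exact hf0 p (Finset.mem_of_mem_filter p hp)
          · intro p hp
            rw [hS₂, Finset.mem_filter, not_lt] at hp
            have hp1 : (1 : ℝ) ≤ p := by
              exact_mod_cast (Nat.prime_of_mem_primeFactors hp.1).one_lt.le
            have hb := hB p hp.2
            rw [Real.norm_of_nonneg (Real.log_nonneg hp1),
              Real.norm_of_nonneg (Real.rpow_nonneg (by linarith) δ)] at hb
            have hc1 : c₀ * (1 / (c₀ + 1)) ≤ 1 := by
              rw [mul_one_div, div_le_one (by linarith)]; linarith
            calc c₀ * Real.log p ≤ c₀ * (1 / (c₀ + 1) * (p : ℝ) ^ δ) :=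
                  mul_le_mul_of_nonneg_left hb hc₀
              _ = c₀ * (1 / (c₀ + 1)) * (p : ℝ) ^ δ := by ring
              _ ≤ 1 * (p : ℝ) ^ δ :=
                  mul_le_mul_of_nonneg_right hc1 (Real.rpow_nonneg (by linarith) δ)
              _ = (p : ℝ) ^ δ := one_mul _
      _ = (∏ p ∈ S₂, (p : ℝ)) ^ δ :=
          Real.finsetProd_rpow S₂ (fun p : ℕ => (p : ℝ)) (fun p _ => Nat.cast_nonneg p) δ
      _ ≤ ((radical n : ℕ) : ℝ) ^ δ :=
          Real.rpow_le_rpow (Finset.prod_nonneg fun p _ => Nat.cast_nonneg p) hsubR hδ.le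
  calc (∏ p ∈ S.filter (fun p : ℕ => (p : ℝ) < B), c₀ * Real.log (p : ℝ)) *
        ∏ p ∈ S.filter (fun p : ℕ => ¬ (p : ℝ) < B), c₀ * Real.log (p : ℝ)
      ≤ M ^ ⌈B⌉₊ * ((radical n : ℕ) : ℝ) ^ δ :=
        mul_le_mul h1 h2
          (Finset.prod_nonneg fun p hp => hf0 p (Finset.mem_of_mem_filter p hp))
          (by positivity)

/-- **Baker's change (i) alone gives subexponential abc.**  If, for every abc triple and every
`u` bounding the exponents in `ca`, Baker's `Ξ` for `Λ = log(c/a)` satisfies the Baker–Wüstholz /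
Matveev-shaped bound with `|Λ|` replaced by `Ξ` — product of the heights of the primes of `ca`,
constant `c₀^{ω(ca)}`, factor `log max(u,3)` all kept — then `∀ ε > 0 ∃ K', log c ≤ K' rad(abc)^ε`.
Proof: `Ξ ≤ rad(b)/max(a,b)`, `∏ (c₀ log p) ≤ C rad(ca)^{ε/2}`, `u = ⌊log₂(ca)⌋`, and
`log max(u,3) ≤ 6 √(1 + log c)`. [cite: Baker2004, §2 (p. 256), change (i)] -/
theorem soloInformed_subexpABC_of_productXi {K c₀ : ℝ} (hK : 0 ≤ K) (hc₀ : 0 ≤ c₀)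
    (hXi : ∀ a b c : ℕ, IsABCTriple a b c → ∀ u : ℕ, (∀ p : ℕ, (c * a).factorization p ≤ u) →
      -(K * (c₀ ^ ω (c * a) * ∏ p ∈ (c * a).primeFactors, Real.log (p : ℝ)) *
          Real.log ((max u 3 : ℕ) : ℝ)) ≤ Real.log (ΞB(a, b, c))) :
    ∀ ε : ℝ, 0 < ε → ∃ K' : ℝ, 0 < K' ∧
      ∀ a b c : ℕ, IsABCTriple a b c → Real.log (c : ℝ) ≤ K' * ((rad a b c : ℕ) : ℝ) ^ ε := by
  intro ε hε
  obtain ⟨C, hC1, hC⟩ := soloInformed_prod_mul_log_le_radical_rpow hc₀ (half_pos hε)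
  have hC0 : 0 < C := by linarith
  set E : ℝ := 4 / ε + 6 * (K * C) with hE_def
  have hE0 : 0 < E := by positivity
  refine ⟨E ^ 2 + 2 * E, by positivity, fun a b c ht => ?_⟩
  obtain ⟨ha, hb, hc, habc⟩ := soloInformed_xi_triple_pos ht
  have ha0 : (0 : ℝ) < a := by exact_mod_cast ha
  have hc0 : (0 : ℝ) < c := by exact_mod_cast hc
  have hc1 : (1 : ℝ) ≤ c := by exact_mod_cast hc
  have hcab : (c : ℝ) = a + b := by exact_mod_cast habc.symm
  have hlc : 0 ≤ Real.log (c : ℝ) := Real.log_nonneg hc1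
  -- the radicals
  have hN2 : (2 : ℝ) ≤ ((rad a b c : ℕ) : ℝ) := by exact_mod_cast ht.two_le_rad
  set N : ℝ := ((rad a b c : ℕ) : ℝ) with hN_def
  have hNeq : N = ((radical (c * a) : ℕ) : ℝ) * ((radical b : ℕ) : ℝ) := by
    rw [hN_def, soloInformed_rad_eq_radical_mul ht]; push_cast; ring
  have hRca1 : (1 : ℝ) ≤ ((radical (c * a) : ℕ) : ℝ) := by exact_mod_cast Nat.radical_pos _
  have hRb1 : (1 : ℝ) ≤ ((radical b : ℕ) : ℝ) := by exact_mod_cast Nat.radical_pos _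
  have hRca_le : ((radical (c * a) : ℕ) : ℝ) ≤ N := by rw [hNeq]; nlinarith
  have hRb_le : ((radical b : ℕ) : ℝ) ≤ N := by rw [hNeq]; nlinarith
  have hN1 : (1 : ℝ) ≤ N := by linarith
  have hN0 : (0 : ℝ) < N := by linarith
  have hlog2 : (0.6931471803 : ℝ) < Real.log 2 := Real.log_two_gt_d9
  have hlogN2 : Real.log 2 ≤ Real.log N := Real.log_le_log two_pos hN2
  have hRb_log : Real.log ((radical b : ℕ) : ℝ) ≤ Real.log N :=
    Real.log_le_log (by linarith) hRb_le
  -- powers of `N`: `T = N^{ε/2}`, `T² = N^ε`, `T ≤ N^ε`, `log N ≤ (2/ε) T`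
  have hNdd : N ^ (ε / 2) * N ^ (ε / 2) = N ^ ε := by
    rw [← Real.rpow_add hN0, add_halves]
  have hNd_le : N ^ (ε / 2) ≤ N ^ ε :=
    Real.rpow_le_rpow_of_exponent_le hN1 (by linarith)
  have hlogN_le : Real.log N ≤ 2 / ε * N ^ (ε / 2) := by
    calc Real.log N ≤ N ^ (ε / 2) / (ε / 2) := Real.log_le_rpow_div hN0.le (half_pos hε)
      _ = 2 / ε * N ^ (ε / 2) := by ring
  set T : ℝ := N ^ (ε / 2) with hT_def
  have hT1 : 1 ≤ T := Real.one_le_rpow hN1 (by positivity)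
  have hT0 : 0 < T := by linarith
  -- the product of the heights is `≤ C T`
  set A : ℝ := c₀ ^ ω (c * a) * ∏ p ∈ (c * a).primeFactors, Real.log (p : ℝ) with hA_def
  have hprod : A = ∏ p ∈ (c * a).primeFactors, c₀ * Real.log (p : ℝ) := by
    rw [hA_def, cardDistinctFactors_eq_card_primeFactors, Finset.prod_mul_distrib,
      Finset.prod_const]
  have hA0 : 0 ≤ A := by
    rw [hprod]
    exact Finset.prod_nonneg fun p hp => mul_nonneg hc₀ (Real.log_nonneg
      (by exact_mod_cast (Nat.prime_of_mem_primeFactors hp).one_lt.le))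
  have hA : A ≤ C * T := by
    rw [hprod]
    calc ∏ p ∈ (c * a).primeFactors, c₀ * Real.log (p : ℝ)
        ≤ C * ((radical (c * a) : ℕ) : ℝ) ^ (ε / 2) := hC (c * a)
      _ ≤ C * T := by
          apply mul_le_mul_of_nonneg_left _ hC0.le
          exact Real.rpow_le_rpow (by linarith) hRca_le (by positivity)
  -- an admissible exponent bound `u = ⌊log₂ (ca)⌋ ≤ 3 log c`
  set u : ℕ := Nat.log 2 (c * a) with hu_def
  have hu : ∀ p : ℕ, (c * a).factorization p ≤ u := by
    intro p
    by_cases hp : p.Prime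
    · apply Nat.le_log_of_pow_le one_lt_two
      calc 2 ^ (c * a).factorization p ≤ p ^ (c * a).factorization p :=
            Nat.pow_le_pow_left hp.two_le _
        _ ≤ c * a := Nat.ordProj_le p (Nat.mul_pos hc ha).ne'
    · rw [Nat.factorization_eq_zero_of_not_prime _ hp]; exact Nat.zero_le _
  have hu_le : (u : ℝ) ≤ 3 * Real.log c := by
    have hfl : ⌊Real.logb 2 ((c * a : ℕ) : ℝ)⌋₊ = u := by
      rw [hu_def, ← Real.natFloor_logb_natCast 2 (c * a)]; norm_num
    have h1 : (u : ℝ) ≤ Real.logb 2 ((c * a : ℕ) : ℝ) := by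
      rw [← hfl]
      exact Nat.floor_le (Real.logb_nonneg one_lt_two
        (by exact_mod_cast Nat.succ_le_of_lt (Nat.mul_pos hc ha)))
    have hca : Real.log ((c * a : ℕ) : ℝ) ≤ 2 * Real.log c := by
      push_cast
      rw [Real.log_mul hc0.ne' ha0.ne']
      have : Real.log (a : ℝ) ≤ Real.log c := Real.log_le_log ha0 (by linarith)
      linarith
    have h2 : (u : ℝ) * Real.log 2 ≤ 2 * Real.log c := by
      rw [Real.logb, le_div_iff₀ (by linarith)] at h1
      exact h1.trans hca
    have h4 : (u : ℝ) * Real.log 2 ≤ 3 * Real.log c * Real.log 2 := by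
      nlinarith [mul_nonneg hlc (show (0 : ℝ) ≤ Real.log 2 - 2 / 3 by linarith)]
    exact le_of_mul_le_mul_right h4 (by linarith)
  -- `s = √(1 + log c)` and `log max(u,3) ≤ 6 s`
  set L : ℝ := Real.log (c : ℝ) with hL_def
  set s : ℝ := Real.sqrt (1 + L) with hs_def
  have hs1 : 1 ≤ s := Real.one_le_sqrt.mpr (by linarith)
  have hs2 : s ^ 2 = 1 + L := Real.sq_sqrt (by linarith)
  have hl : Real.log (1 + L) ≤ 2 * s := by
    have h1 := Real.log_le_rpow_div (show (0 : ℝ) ≤ 1 + L by linarith)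
      (show (0 : ℝ) < 1 / 2 by norm_num)
    rw [← Real.sqrt_eq_rpow] at h1
    have h2 : Real.sqrt (1 + L) / (1 / 2) = 2 * s := by rw [hs_def]; ring
    linarith [h2]
  have hm1 : (1 : ℝ) ≤ ((max u 3 : ℕ) : ℝ) := by
    exact_mod_cast le_trans (by norm_num) (le_max_right u 3)
  have hmax : Real.log ((max u 3 : ℕ) : ℝ) ≤ 6 * s := by
    have hm3 : ((max u 3 : ℕ) : ℝ) ≤ 3 * (1 + L) := by
      push_cast
      exact max_le (by linarith) (by linarith)
    have hlog3 : Real.log 3 ≤ 2 := by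
      have := Real.log_le_sub_one_of_pos (show (0 : ℝ) < 3 by norm_num); linarith
    calc Real.log ((max u 3 : ℕ) : ℝ) ≤ Real.log (3 * (1 + L)) :=
          Real.log_le_log (by linarith) hm3
      _ = Real.log 3 + Real.log (1 + L) := Real.log_mul (by norm_num) (by linarith)
      _ ≤ 6 * s := by linarith
  -- Baker's estimate at `u`, against the upper bound for `Ξ`
  have hXi0 : 0 < ΞB(a, b, c) := soloInformed_bakerXi_pos ht
  have hM0 : (0 : ℝ) < max (a : ℝ) b := lt_max_of_lt_left ha0
  have hup : Real.log (ΞB(a, b, c)) ≤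
      Real.log ((radical b : ℕ) : ℝ) - Real.log (max (a : ℝ) b) := by
    rw [← Real.log_div (by positivity) hM0.ne']
    exact Real.log_le_log hXi0 (soloInformed_bakerXi_le ht)
  have hlow := hXi a b c ht u hu
  rw [← hA_def] at hlow
  have h1 : K * A * Real.log ((max u 3 : ℕ) : ℝ) ≤ 6 * (K * C) * (T * s) := by
    calc K * A * Real.log ((max u 3 : ℕ) : ℝ) ≤ K * (C * T) * (6 * s) :=
          mul_le_mul (mul_le_mul_of_nonneg_left hA hK) hmax (Real.log_nonneg hm1)
            (by positivity)
      _ = 6 * (K * C) * (T * s) := by ring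
  have hcmax : L ≤ Real.log 2 + Real.log (max (a : ℝ) b) := by
    rw [hL_def, ← Real.log_mul two_ne_zero hM0.ne']
    apply Real.log_le_log hc0
    rw [hcab]; linarith [le_max_left (a : ℝ) b, le_max_right (a : ℝ) b]
  -- `L ≤ D s` with `D = E T`, hence `s ≤ D + 1` and `L ≤ D² + 2D ≤ (E² + 2E) N^ε`
  have hs0 : 0 < s := by linarith
  have hTs : T ≤ T * s := by
    have h := mul_le_mul_of_nonneg_left hs1 hT0.le
    linarith [h, mul_one T]
  have hLN : 2 * Real.log N ≤ 4 / ε * (T * s) := by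
    have h4 : (0 : ℝ) ≤ 4 / ε := by positivity
    have step1 : 2 * Real.log N ≤ 2 * (2 / ε * T) := by linarith [hlogN_le]
    have step2 : 2 * (2 / ε * T) = 4 / ε * T := by ring
    have step3 : 4 / ε * T ≤ 4 / ε * (T * s) := mul_le_mul_of_nonneg_left hTs h4
    linarith [step1, step2, step3]
  set D : ℝ := E * T with hD_def
  have hD0 : 0 ≤ D := by rw [hD_def]; positivity
  have hLD : L ≤ D * s := by
    calc L ≤ 2 * Real.log N + 6 * (K * C) * (T * s) := by linarith
      _ ≤ 4 / ε * (T * s) + 6 * (K * C) * (T * s) := by linarith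
      _ = D * s := by rw [hD_def, hE_def]; ring
  have hsD : s ≤ D + 1 := by
    by_contra hlt
    push Not at hlt
    have h1' : (D + 1) * s < s * s := mul_lt_mul_of_pos_right hlt hs0
    have h2' : s * s = 1 + L := by rw [← hs2]; ring
    have h3' : (D + 1) * s = D * s + s := by ring
    linarith [h1', h2', h3', hLD, hs1]
  have hL3 : L ≤ D ^ 2 + 2 * D := by
    have h' : s ^ 2 ≤ (D + 1) ^ 2 := pow_le_pow_left₀ hs0.le hsD 2
    have h'' : (D + 1) ^ 2 = D ^ 2 + 2 * D + 1 := by ring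
    rw [h''] at h'
    linarith
  have h2E : 2 * E * T ≤ 2 * E * N ^ ε := mul_le_mul_of_nonneg_left hNd_le (by positivity)
  calc L ≤ D ^ 2 + 2 * D := hL3
    _ = E ^ 2 * (T * T) + 2 * E * T := by rw [hD_def]; ring
    _ = E ^ 2 * N ^ ε + 2 * E * T := by rw [hNdd]
    _ ≤ E ^ 2 * N ^ ε + 2 * E * N ^ ε := by linarith
    _ = (E ^ 2 + 2 * E) * N ^ ε := by ring

end Summit.ABC.ABC.Theorems
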